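import Mathlib
import Literature.NumberTheory.GaloisRepresentations.GaloisRep
import Literature.NumberTheory.GaloisRepresentations.IntegralGaloisActionProofs
import Summits.Langlands.Langlands.Theorems.PhantomRMYoshidaStableYoshidaCongruenceSteinbergMonodromy
import Summits.Langlands.Langlands.Theorems.PhantomRMYoshidaStableYoshidaCongruenceSteinbergEigenvalueRatio
import HarnessLib

/-!
# Route `PhantomRMYoshida`, crux `StableYoshidaCongruence` (stmt-Langlands-13640), line
# `serre-dual-ribet-square`: Stub 2 `stub_steinbergCongruence` — Ribet's necessary condition for
# level raising on the Galois side (the Steinberg congruence), assembled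

Let `p` be a prime, `v ∤ p` a finite place of `ℚ`, and `ρ₁ : Γ_ℚ → GL₂(ℚ̄_p)` a continuous representation
whose inertia at `v` acts UNIPOTENTLY (`(ρ₁ τ - 1)² = 0` for every `τ ∈ I_𝔓`, `𝔓 ∣ v`) and which is
RAMIFIED at `v`.  If the Frobenius polynomial of `ρ₁` at `v` is `Q ∈ 𝒪_{ℚ̄_p}[X]` and `Q` reduces through
`red : 𝒪_{ℚ̄_p} → k` to `(X - a)(X - b)`, then `a = q_v b` or `b = q_v a` (`q_v = N v`): the two residual
Frobenius roots of a representation with Steinberg-shaped (unipotent, non-trivial) monodromy at `v` are in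
ratio `q_v`.  This is the Galois-side shadow of Ribet's level-raising condition `a_v² ≡ (q_v+1)²`
(Ribet, ICM 1983; Diamond–Taylor 1994 §1; Carayol 1986), obtained here with NO automorphic input from

* the Grothendieck monodromy relation `ρ₁(φ) N = q_v • (N ρ₁(φ))`, `N = ρ₁(τ) - 1`, for every `τ ∈ I_𝔓`
  and every arithmetic Frobenius `φ` at `𝔓` (`stub_steinbergMonodromy`, landed as
  `…SteinbergMonodromyTame.lean` + `…SteinbergMonodromy.lean`: number-field ramification theory at
  `𝔓 ⊂ ℤ̄`, tame Frobenius law `f(φτφ⁻¹) = f(τ)^{q_v}` at finite level), and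
* the linear-algebra tail (`stub_steinbergEigenvalueRatio`, `…SteinbergEigenvalueRatio.lean`: `F N = q N F`
  with `N ≠ 0`, `N² = 0` forces `charpoly F = (X - qβ)(X - β)`; integrality of the roots in the
  valuation ring; reduction).

The statement below is byte-identical to the stub registered on the crux item by the line's planner
(skeleton `Cruxes/StableYoshidaCongruence/Lines/serre_dual_ribet_square.lean`), where it kills the
endoscopic branch (B) of the Ribet package at a cross-ONLY place.  Lead prover-line-stmt-Langlands-13640-c2-0
(2026-08-16).  Everything used is proved in the tree; no named fact is taken as a hypothesis.
-/

-- `Summit.Langlands.Langlands.…` (summit = sub-problem name, D-0017 layout) trips `dupNamespace` on every decl.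
set_option linter.dupNamespace false

noncomputable section

open Polynomial IsDedekindDomain
open scoped NumberField
open Literature.NumberTheory.GaloisRepresentations

namespace Summit.Langlands.Langlands.Cruxes.StableYoshidaCongruence.SerreDualRibetSquare

/-- A ramified framed representation has, at some prime `𝔓 ∣ v`, an inertia element `τ` with
`ρ₁ τ ≠ 1`, i.e. `N = ρ₁ τ - 1 ≠ 0` as a matrix. [folklore] -/
theorem exists_inertia_sub_one_ne_zero {p : ℕ} [Fact p.Prime] {n : ℕ}
    {v : HeightOneSpectrum (𝓞 ℚ)} {ρ₁ : FramedGaloisRep ℚ (PadicAlgCl p) n}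
    (hram : ¬ ρ₁.IsUnramifiedAt v) :
    ∃ 𝔓 ∈ v.primesAbove, ∃ τ ∈ 𝔓.inertia (Field.absoluteGaloisGroup ℚ),
      (((ρ₁ τ : GL (Fin n) (PadicAlgCl p)) : Matrix (Fin n) (Fin n) (PadicAlgCl p)) - 1) ≠ 0 := by
  simp only [FramedGaloisRep.IsUnramifiedAt, not_forall, exists_prop] at hram
  obtain ⟨𝔓, h𝔓, τ, hτ, hne⟩ := hram
  exact ⟨𝔓, h𝔓, τ, hτ, fun h => hne (Units.ext (sub_eq_zero.mp h))⟩

/-- **The Steinberg congruence (Ribet's necessary condition for level raising, Galois side).**  Let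
`v ∤ p` be a finite place of `ℚ` and `ρ₁ : Γ_ℚ → GL₂(ℚ̄_p)` continuous with unipotent inertia at `v`
(`(ρ₁ τ - 1)² = 0` on every `I_𝔓`, `𝔓 ∣ v`) and RAMIFIED at `v`.  If the Frobenius polynomial of `ρ₁` at
`v` is `Q ∈ 𝒪_{ℚ̄_p}[X]` (`HasFrobCharpolyAt`) and `Q` reduces through `red` to `(X - a)(X - b)`, then
`a = q_v b ∨ b = q_v a`.  Proof: ramification gives `𝔓 ∣ v` and `τ ∈ I_𝔓` with `N := ρ₁ τ - 1 ≠ 0`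
(and `N² = 0` by hypothesis); an arithmetic Frobenius `φ` at `𝔓` exists
(`exists_isArithFrobAt_of_mem_primesAbove_holds`); the monodromy relation (`stub_steinbergMonodromy`)
gives `ρ₁(φ) N = q_v • (N ρ₁(φ))`, the hypothesis gives `charpoly ρ₁(φ) = Q`, and
`stub_steinbergEigenvalueRatio` concludes.
(Ribet's level-raising theorem, Proc. ICM 1983, is quoted as Thm A of Diamond–Taylor.)
[cite: DiamondTaylor1994, §1 and Thm A] [cite: Carayol1986] [cite: SerreTate1968, Appendix (Grothendieck monodromy)] -/
theorem stub_steinbergCongruence :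
    ∀ (p : ℕ) [Fact p.Prime] (k : Type) [Field k]
      (red : Valued.integer (PadicAlgCl p) →+* k)
      (v : HeightOneSpectrum (NumberField.RingOfIntegers ℚ))
      (ρ₁ : FramedGaloisRep ℚ (PadicAlgCl p) 2)
      (Q : Polynomial (Valued.integer (PadicAlgCl p))) (a b : k),
      ((p : ℕ) : NumberField.RingOfIntegers ℚ) ∉ v.asIdeal →
      (∀ 𝔓 ∈ v.primesAbove, ∀ τ ∈ 𝔓.inertia (Field.absoluteGaloisGroup ℚ),
        (((ρ₁ τ : GL (Fin 2) (PadicAlgCl p)) : Matrix (Fin 2) (Fin 2) (PadicAlgCl p)) - 1) ^ 2 = 0) →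
      ¬ ρ₁.IsUnramifiedAt v →
      ρ₁.HasFrobCharpolyAt v (Q.map (Valued.integer (PadicAlgCl p)).subtype) →
      Q.map red = (X - C a) * (X - C b) →
      (a = (v.residueCard : k) * b ∨ b = (v.residueCard : k) * a) := by
  intro p _ k _ red v ρ₁ Q a b hv huni hram hQ hred
  obtain ⟨𝔓, h𝔓, τ, hτ, hN0⟩ := exists_inertia_sub_one_ne_zero hram
  obtain ⟨φ, hφ⟩ := HeightOneSpectrum.exists_isArithFrobAt_of_mem_primesAbove_holds (K := ℚ) (v := v) h𝔓
  exact stub_steinbergEigenvalueRatio p k red v.residueCard _ _ Q a b hN0 (huni 𝔓 h𝔓 τ hτ)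
    (stub_steinbergMonodromy p v ρ₁ hv huni 𝔓 h𝔓 τ hτ φ hφ) (hQ 𝔓 h𝔓 φ hφ) hred

end Summit.Langlands.Langlands.Cruxes.StableYoshidaCongruence.SerreDualRibetSquare

end
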